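import Mathlib
import Literature.NumberTheory.Transcendental.KZCubeRationalMoves
import Literature.NumberTheory.Transcendental.KZFibreMapMove
import Literature.NumberTheory.Transcendental.KZSemiCanonicalReductionProofs
import Literature.NumberTheory.Transcendental.KZCalculus
import Summits.KontsevichZagierPeriods.KontsevichZagierPeriods.Theorems.SoloBlindZetaTwoCharts
import Summits.KontsevichZagierPeriods.KontsevichZagierPeriods.Theorems.SoloBlindEta
import HarnessLib

/-!
# Arctan-fibre calculus for `RationalCubePiKernelSingle` (route `RootDecompRationalCubeDichotomy`, crux stmt-KontsevichZagierPeriods-26322) at `m = 2` · part 1/9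

Cell `decomp-kz`, lens 2 (decomp-kz-lens-2 g7): the GENERIC (arctan-fibre) side of the first open rung `m = 2` of
`RationalCubePiKernelSingle` decided INSIDE the Kontsevich–Zagier calculus with `N = 0`, by rules 1+2 only: fibred Möbius
charts `x ↦ x(q+r)/(q+rx)` (`MoebiusData.rel`), the TANGENT-ADDITION chart `x ↦ x(1−p)/(1−px²)` = the group law of
`tan` as a move (`TanData.tan_add`), Serret's base involution `y ↦ (1−y)/(1+y)` (`rel_serret`), one moving-centre
dissection with null surgery (§8), odd-symmetry vanishing (§7b).  Decided census classes: `π·log 2` (`pilog2_rel`,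
census pair #33), Catalan (`catalan_rel`, #32), dilogarithm classes `dilogA_rel` (#28), `dilogB_rel` (#30),
`dilogC_rel` (#24), seven moment relations; §9 the LITERAL binder instances of `RationalCubePiKernelSingle` at
`m = 2`, `N = 0` (the route decl is not referenced by name, so these modules do not import the route file);
§10 six UNIFORM CLASSES `single_classSwap/Reflect/Halve/Moebius/Serret/TanAdd`.

Source: `HOME/decomp-kz-lens-2/g7/ArctanFibreCalculus.lean` sha256 964497cf335d1c59 (2144 l; critic decomp-kz-crit-1 g2
CLEARED 2026-08-30T09:13:02Z incl. transcription numerics, std axioms), split into 9 modules by the landing seat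
decomp-kz-census-1 g7 (contexts re-opened per part; generic docstrings added where the source had none).
No `sorry`; standard axioms.  References: [cite: KontsevichZagier2001, §1.2]; J.-A. Serret (1844).
-/

noncomputable section

open Set MeasureTheory MvPolynomial
open Literature.ModelTheory.ExponentialFields (IsSemialgebraic)
open Literature.NumberTheory.Transcendental
open Literature.NumberTheory.Transcendental.KZ
open Literature.NumberTheory.Transcendental.KZ.RFun
open Summit.KontsevichZagierPeriods.KontsevichZagierPeriods.Theorems

namespace Summit.KontsevichZagierPeriods.RootDecompRationalCubeDichotomy.ArctanFibre

/-! ## 0. Generalities (as in generation 6) -/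

/-- `[0,1]^{M+1}` is the band over `[0,1]^M` with edges `0` and `1`. -/
private theorem cube_succ_eq_band (M : ℕ) :
    KZ.cube (M + 1) = KZlog.band (KZ.cube M) (fun _ => (0 : ℝ)) (fun _ => 1) := by
  rw [KZ.cube_succ_eq]; rfl

/-- **Fibred substitution for regular rational functions** (the landed move
`KZ.of_sub_of_mem_relations_of_fibreMap` on the closed cube, tameness discharged). -/
private theorem rel_fibreMap {M : ℕ} (T S U : RFun (M + 1)) (ψs : (Fin (M + 1) → ℝ) → ℝ)
    (hderiv : ∀ z ∈ KZ.cube (M + 1),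
      HasDerivAt (fun s : ℝ => U.fn (Fin.snoc (Fin.init z) s)) (ψs z) (z (Fin.last M)))
    (hpos : ∀ z ∈ KZ.cube (M + 1), 0 < ψs z)
    (h0 : ∀ x ∈ KZ.cube M, U.fn (Fin.snoc x 0) = 0)
    (h1 : ∀ x ∈ KZ.cube M, U.fn (Fin.snoc x 1) = 1)
    (hint : ∀ z ∈ KZ.cube (M + 1), T.fn z = S.fn (Fin.snoc (Fin.init z) (U.fn z)) * ψs z) :
    KZ.of T.rep - KZ.of S.rep ∈ KZ.relations :=
  KZ.of_sub_of_mem_relations_of_fibreMap (G := KZ.cube M) (a := fun _ => (0 : ℝ))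
    (b := fun _ => (1 : ℝ)) (a' := fun _ => (0 : ℝ)) (b' := fun _ => (1 : ℝ)) U.fn ψs T.rep S.rep
    (cube_succ_eq_band M) (cube_succ_eq_band M) (fun _ _ => zero_le_one)
    U.isSemialgebraicFunOn_fn (fun z hz => (U.analyticOnNhd_fn z hz).differentiableAt)
    hderiv hpos h0 h1 hint

/-- `mem_cube_two`: auxiliary theorem of the arctan-fibre calculus for `RationalCubePiKernelSingle` (stmt-26322) — see the module docstring; verbatim from the lens file. -/
private theorem mem_cube_two {z : Fin 2 → ℝ} (hz : z ∈ KZ.cube 2) :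
    (0 ≤ z 0 ∧ z 0 ≤ 1) ∧ (0 ≤ z 1 ∧ z 1 ≤ 1) := ⟨hz 0, hz 1⟩

/-- `init_mem_cube_one`: auxiliary theorem of the arctan-fibre calculus for `RationalCubePiKernelSingle` (stmt-26322) — see the module docstring; verbatim from the lens file. -/
private theorem init_mem_cube_one {z : Fin 2 → ℝ} (hz : z ∈ KZ.cube 2) : Fin.init z ∈ KZ.cube 1 :=
  fun i => hz (Fin.castSucc i)

/-- `mem_cube_one_iff`: auxiliary theorem of the arctan-fibre calculus for `RationalCubePiKernelSingle` (stmt-26322) — see the module docstring; verbatim from the lens file. -/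
private theorem mem_cube_one_iff {y : Fin 1 → ℝ} : y ∈ KZ.cube 1 ↔ 0 ≤ y 0 ∧ y 0 ≤ 1 := by
  rw [KZ.mem_cube]
  exact ⟨fun h => h 0, fun h i => by fin_cases i; exact h⟩

/-- Points of the square given by two coordinates in `[0,1]`. -/
private theorem vec_mem_cube_two {a b : ℝ} (ha : 0 ≤ a ∧ a ≤ 1) (hb : 0 ≤ b ∧ b ≤ 1) :
    (![a, b] : Fin 2 → ℝ) ∈ KZ.cube 2 := by
  intro i; fin_cases i
  · exact ha
  · exact hb

/-- `snoc_two_zero`: auxiliary theorem of the arctan-fibre calculus for `RationalCubePiKernelSingle` (stmt-26322) — see the module docstring; verbatim from the lens file. -/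
@[simp] private theorem snoc_two_zero (y : Fin 1 → ℝ) (s : ℝ) : (Fin.snoc y s : Fin 2 → ℝ) 0 = y 0 := rfl

/-- `snoc_two_one`: auxiliary theorem of the arctan-fibre calculus for `RationalCubePiKernelSingle` (stmt-26322) — see the module docstring; verbatim from the lens file. -/
@[simp] private theorem snoc_two_one (y : Fin 1 → ℝ) (s : ℝ) : (Fin.snoc y s : Fin 2 → ℝ) 1 = s := rfl

/-- `init_apply_zero`: auxiliary theorem of the arctan-fibre calculus for `RationalCubePiKernelSingle` (stmt-26322) — see the module docstring; verbatim from the lens file. -/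
@[simp] private theorem init_apply_zero (z : Fin 2 → ℝ) : Fin.init z 0 = z 0 := rfl

/-- `snoc (init z) u = (z 0, u)`. -/
theorem snoc_init_eq (z : Fin 2 → ℝ) (u : ℝ) : (Fin.snoc (Fin.init z) u : Fin 2 → ℝ) = ![z 0, u] := by
  funext i; fin_cases i <;> rfl

/-- `z = (z 0, z 1)`. -/
private theorem vec_eta (z : Fin 2 → ℝ) : z = ![z 0, z 1] := by
  funext i; fin_cases i <;> rfl

/-- `vec_zero`: auxiliary theorem of the arctan-fibre calculus for `RationalCubePiKernelSingle` (stmt-26322) — see the module docstring; verbatim from the lens file. -/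
@[simp] private theorem vec_zero (a b : ℝ) : (![a, b] : Fin 2 → ℝ) 0 = a := rfl
/-- `vec_one`: auxiliary theorem of the arctan-fibre calculus for `RationalCubePiKernelSingle` (stmt-26322) — see the module docstring; verbatim from the lens file. -/
@[simp] private theorem vec_one (a b : ℝ) : (![a, b] : Fin 2 → ℝ) 1 = b := rfl

/-- The one-variable function `t ↦ E(t)` of `E : RFun 1`. -/
def ev (E : RFun 1) (t : ℝ) : ℝ := E.fn (fun _ => t)

/-- `fn_eq_ev`: auxiliary theorem of the arctan-fibre calculus for `RationalCubePiKernelSingle` (stmt-26322) — see the module docstring; verbatim from the lens file. -/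
theorem fn_eq_ev (E : RFun 1) (y : Fin 1 → ℝ) : E.fn y = ev E (y 0) := by
  unfold ev; congr 1; funext i; fin_cases i; rfl

/-- `aeval` at a `snoc` point of a polynomial in the first variables. -/
private theorem aeval_snoc_rename {M : ℕ} (P : MvPolynomial (Fin M) ℚ) (x : Fin M → ℝ) (s : ℝ) :
    aeval (Fin.snoc x s : Fin (M + 1) → ℝ) (MvPolynomial.rename Fin.castSucc P) = aeval x P := by
  have h : ((Fin.snoc x s : Fin (M + 1) → ℝ) ∘ Fin.castSucc) = x := by
    funext i
    simp [Function.comp]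
  rw [aeval_rename, h]

/-- `aeval_lift_num`: auxiliary theorem of the arctan-fibre calculus for `RationalCubePiKernelSingle` (stmt-26322) — see the module docstring; verbatim from the lens file. -/
private theorem aeval_lift_num (E : RFun 1) (z : Fin 2 → ℝ) :
    aeval z E.lift.num = aeval (Fin.init z) E.num := by
  show aeval z (MvPolynomial.rename Fin.castSucc E.num) = _
  rw [aeval_rename]; rfl

/-- `aeval_lift_den`: auxiliary theorem of the arctan-fibre calculus for `RationalCubePiKernelSingle` (stmt-26322) — see the module docstring; verbatim from the lens file. -/
private theorem aeval_lift_den (E : RFun 1) (z : Fin 2 → ℝ) :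
    aeval z E.lift.den = aeval (Fin.init z) E.den := by
  show aeval z (MvPolynomial.rename Fin.castSucc E.den) = _
  rw [aeval_rename]; rfl

/-- `ev_eq_div`: auxiliary theorem of the arctan-fibre calculus for `RationalCubePiKernelSingle` (stmt-26322) — see the module docstring; verbatim from the lens file. -/
theorem ev_eq_div (E : RFun 1) (y : Fin 1 → ℝ) :
    ev E (y 0) = aeval y E.num / aeval y E.den := by
  rw [← fn_apply, fn_eq_ev]

/-- Clearing the denominator of `E : RFun 1` on `[0,1]`: `num = ev · den`. -/
theorem num_eq_ev_mul_den (E : RFun 1) {y : Fin 1 → ℝ} (hy : y ∈ KZ.cube 1) :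
    aeval y E.num = ev E (y 0) * aeval y E.den := by
  rw [ev_eq_div, div_mul_cancel₀ _ (E.den_ne y hy)]

/-- Natural-number multiples: `[c·T] ≡ c • [T]`. -/
private theorem rel_constMul (c : ℕ) (T : RFun 2) :
    KZ.of (((const (c : ℚ)).mul T)).rep - c • KZ.of T.rep ∈ KZ.relations :=
  SoloBlind.of_sub_nsmul_mem_relations c rfl fun x _ => by
    simp only [rep_integrand, fn_mul, fn_const, Rat.cast_natCast]

/-- `Set.pi univ [0,1] = KZ.cube`. -/
theorem pi_univ_Icc_eq_cube (m : ℕ) :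
    Set.pi Set.univ (fun _ : Fin m => Icc (0 : ℝ) 1) = KZ.cube m := by
  ext z; simp only [Set.mem_pi, Set.mem_univ, true_implies, mem_Icc, KZ.mem_cube]

/-- A closed-square representation presented by an `RFun` whose class is a relation satisfies the
conclusion of `RationalCubePiKernelSingle` with `N = 0`. -/
theorem single_of_rel (D : RFun 2) (hD : KZ.of D.rep ∈ KZ.relations) (q : KZ.IntegralRep 2)
    (hdom : q.domain = Set.pi Set.univ (fun _ : Fin 2 => Icc (0 : ℝ) 1))
    (hint : ∀ z ∈ Set.pi Set.univ (fun _ : Fin 2 => Icc (0 : ℝ) 1),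
      q.integrand z = MvPolynomial.aeval z D.num / MvPolynomial.aeval z D.den) :
    ∃ N : ℕ, (fun y : KZ.FormalRep => KZ.of KZ.piRep * y)^[N] (KZ.of q) ∈ KZ.relations := by
  refine ⟨0, ?_⟩
  show KZ.of q ∈ KZ.relations
  have hd : D.rep.domain = q.domain := by rw [hdom, rep_domain, pi_univ_Icc_eq_cube]
  have he : KZ.of q - KZ.of D.rep ∈ KZ.relations :=
    KZ.of_sub_of_mem_relations_of_eqOn hd fun z hz => by
      rw [rep_integrand, fn_apply]; exact hint z (hdom ▸ hz)
  simpa using add_mem he hD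

/-! ## 1. Structural moves on regular rational functions: swap, reflections, halving -/

/-- The coordinate swap `T(x, y) ↦ T(y, x)`. -/
def swap (T : RFun 2) : RFun 2 := T.rename (Equiv.swap (0 : Fin 2) 1)

/-- `fn_swap`: auxiliary theorem of the arctan-fibre calculus for `RationalCubePiKernelSingle` (stmt-26322) — see the module docstring; verbatim from the lens file. -/
theorem fn_swap (T : RFun 2) (z : Fin 2 → ℝ) : (swap T).fn z = T.fn ![z 1, z 0] := by
  rw [swap, fn_rename]
  congr 1
  funext i; fin_cases i <;> simp [Equiv.swap_apply_left, Equiv.swap_apply_right]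

/-- **Swap move** `[T] ≡ [swap T]`. -/
theorem rel_swap (T : RFun 2) : KZ.of T.rep - KZ.of (swap T).rep ∈ KZ.relations := rel_rename T _

/-- Box reflections preserve the closed cube. -/
theorem boxReflection_mem_cube {M : ℕ} (j : Fin M) {x : Fin M → ℝ} (hx : x ∈ KZ.cube M) :
    KZ.boxReflection j x ∈ KZ.cube M := by
  intro i
  by_cases h : i = j
  · subst h; rw [KZ.boxReflection_apply_self]; constructor <;> linarith [(hx i).1, (hx i).2]
  · rw [KZ.boxReflection_apply_of_ne h]; exact hx i

/-- `boxReflection_preimage_cube`: auxiliary theorem of the arctan-fibre calculus for `RationalCubePiKernelSingle` (stmt-26322) — see the module docstring; verbatim from the lens file. -/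
theorem boxReflection_preimage_cube {M : ℕ} (j : Fin M) :
    KZ.boxReflection j ⁻¹' KZ.cube M = KZ.cube M := by
  ext x
  constructor
  · intro h
    have := boxReflection_mem_cube j h
    rwa [KZ.boxReflection_boxReflection] at this
  · intro h
    exact boxReflection_mem_cube j h

/-- The reflection `x_j ↦ 1 − x_j` of a regular rational function. -/
def reflect {M : ℕ} (j : Fin M) (T : RFun M) : RFun M :=
  T.subst (KZ.reflectSubst j) (fun y hy => by
    rw [KZ.aeval_reflectSubst_eq]; exact boxReflection_mem_cube j hy)

/-- `fn_reflect`: auxiliary theorem of the arctan-fibre calculus for `RationalCubePiKernelSingle` (stmt-26322) — see the module docstring; verbatim from the lens file. -/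
theorem fn_reflect {M : ℕ} (j : Fin M) (T : RFun M) (x : Fin M → ℝ) :
    (reflect j T).fn x = T.fn (KZ.boxReflection j x) := by
  rw [reflect, fn_subst, KZ.aeval_reflectSubst_eq]

/-- `fn_reflect_zero`: auxiliary theorem of the arctan-fibre calculus for `RationalCubePiKernelSingle` (stmt-26322) — see the module docstring; verbatim from the lens file. -/
theorem fn_reflect_zero (T : RFun 2) (z : Fin 2 → ℝ) : (reflect 0 T).fn z = T.fn ![1 - z 0, z 1] := by
  rw [fn_reflect]; congr 1; funext i; fin_cases i <;> rfl

/-- `fn_reflect_one`: auxiliary theorem of the arctan-fibre calculus for `RationalCubePiKernelSingle` (stmt-26322) — see the module docstring; verbatim from the lens file. -/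
theorem fn_reflect_one (T : RFun 2) (z : Fin 2 → ℝ) : (reflect 1 T).fn z = T.fn ![z 0, 1 - z 1] := by
  rw [fn_reflect]; congr 1; funext i; fin_cases i <;> rfl

/-- **Reflection move** `[reflect j T] ≡ [T]`. -/
theorem rel_reflect {M : ℕ} (j : Fin M) (T : RFun M) :
    KZ.of (reflect j T).rep - KZ.of T.rep ∈ KZ.relations :=
  KZ.of_sub_of_mem_relations_of_boxReflection j
    (by rw [rep_domain, rep_domain, boxReflection_preimage_cube])
    (fun x _ => by rw [rep_integrand, rep_integrand, fn_reflect])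

/-- **Halving move** (dyadic subdivision along the coordinate `i`):
`[T] ≡ [½ T(…, xᵢ/2, …)] + [½ T(…, (1+xᵢ)/2, …)]`. -/
theorem rel_halve {M : ℕ} (i : Fin M) (T T₁ T₂ : RFun M)
    (h₁ : ∀ x ∈ KZ.cube M, T₁.fn x = (1 / 2 : ℝ) * T.fn (Function.update x i (x i / 2)))
    (h₂ : ∀ x ∈ KZ.cube M, T₂.fn x = (1 / 2 : ℝ) * T.fn (Function.update x i ((1 + x i) / 2))) :
    KZ.of T.rep - KZ.of T₁.rep - KZ.of T₂.rep ∈ KZ.relations :=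
  KZ.cubicalSubdivGens_subset_relations
    (KZ.mem_cubicalSubdivGens T.isTameCube_rep T₁.isTameCube_rep T₂.isTameCube_rep i h₁ h₂)

/-- `update_zero_eq`: auxiliary theorem of the arctan-fibre calculus for `RationalCubePiKernelSingle` (stmt-26322) — see the module docstring; verbatim from the lens file. -/
private theorem update_zero_eq (z : Fin 2 → ℝ) (u : ℝ) : Function.update z 0 u = ![u, z 1] := by
  funext i; fin_cases i <;> rfl

/-- `update_one_eq`: auxiliary theorem of the arctan-fibre calculus for `RationalCubePiKernelSingle` (stmt-26322) — see the module docstring; verbatim from the lens file. -/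
theorem update_one_eq (z : Fin 2 → ℝ) (u : ℝ) : Function.update z 1 u = ![z 0, u] := by
  funext i; fin_cases i <;> rfl

/-! ## 2. Fibred Möbius charts `x ↦ x(q+r)/(q+rx)` -/

/-- The value `P(t)` of a one-variable polynomial. -/
def pv (P : MvPolynomial (Fin 1) ℚ) (t : ℝ) : ℝ := aeval (fun _ : Fin 1 => t) P

/-- `aeval_eq_pv`: auxiliary theorem of the arctan-fibre calculus for `RationalCubePiKernelSingle` (stmt-26322) — see the module docstring; verbatim from the lens file. -/
theorem aeval_eq_pv (P : MvPolynomial (Fin 1) ℚ) (y : Fin 1 → ℝ) : aeval y P = pv P (y 0) := by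
  have hy : y = fun _ : Fin 1 => y 0 := by funext i; fin_cases i; rfl
  unfold pv
  exact congrArg (fun v : Fin 1 → ℝ => aeval v P) hy

/-- `aeval_rename_two`: auxiliary theorem of the arctan-fibre calculus for `RationalCubePiKernelSingle` (stmt-26322) — see the module docstring; verbatim from the lens file. -/
theorem aeval_rename_two (P : MvPolynomial (Fin 1) ℚ) (z : Fin 2 → ℝ) :
    aeval z (MvPolynomial.rename Fin.castSucc P) = pv P (z 0) := by
  rw [aeval_rename, aeval_eq_pv]; rfl

/-- `pv_X`: auxiliary theorem of the arctan-fibre calculus for `RationalCubePiKernelSingle` (stmt-26322) — see the module docstring; verbatim from the lens file. -/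
@[simp] theorem pv_X (t : ℝ) : pv (X 0) t = t := by simp [pv]
/-- `pv_C`: auxiliary theorem of the arctan-fibre calculus for `RationalCubePiKernelSingle` (stmt-26322) — see the module docstring; verbatim from the lens file. -/
@[simp] theorem pv_C (c : ℚ) (t : ℝ) : pv (C c) t = c := by simp [pv]
/-- `pv_one`: auxiliary theorem of the arctan-fibre calculus for `RationalCubePiKernelSingle` (stmt-26322) — see the module docstring; verbatim from the lens file. -/
@[simp] theorem pv_one (t : ℝ) : pv 1 t = 1 := by simp [pv]
/-- `pv_add`: auxiliary theorem of the arctan-fibre calculus for `RationalCubePiKernelSingle` (stmt-26322) — see the module docstring; verbatim from the lens file. -/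
@[simp] theorem pv_add (P Q : MvPolynomial (Fin 1) ℚ) (t : ℝ) : pv (P + Q) t = pv P t + pv Q t := by
  simp [pv]
/-- `pv_sub`: auxiliary theorem of the arctan-fibre calculus for `RationalCubePiKernelSingle` (stmt-26322) — see the module docstring; verbatim from the lens file. -/
@[simp] theorem pv_sub (P Q : MvPolynomial (Fin 1) ℚ) (t : ℝ) : pv (P - Q) t = pv P t - pv Q t := by
  simp [pv]
/-- `pv_mul`: auxiliary theorem of the arctan-fibre calculus for `RationalCubePiKernelSingle` (stmt-26322) — see the module docstring; verbatim from the lens file. -/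
@[simp] theorem pv_mul (P Q : MvPolynomial (Fin 1) ℚ) (t : ℝ) : pv (P * Q) t = pv P t * pv Q t := by
  simp [pv]
/-- `pv_neg`: auxiliary theorem of the arctan-fibre calculus for `RationalCubePiKernelSingle` (stmt-26322) — see the module docstring; verbatim from the lens file. -/
@[simp] theorem pv_neg (P : MvPolynomial (Fin 1) ℚ) (t : ℝ) : pv (-P) t = -pv P t := by
  simp [pv]
/-- `pv_pow`: auxiliary theorem of the arctan-fibre calculus for `RationalCubePiKernelSingle` (stmt-26322) — see the module docstring; verbatim from the lens file. -/
@[simp] theorem pv_pow (P : MvPolynomial (Fin 1) ℚ) (n : ℕ) (t : ℝ) : pv (P ^ n) t = pv P t ^ n := by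
  simp [pv]

/-- A convex combination of `q > 0` and `q + r > 0` is positive. -/
theorem convex_pos {q r x : ℝ} (hq : 0 < q) (hqr : 0 < q + r) (hx0 : 0 ≤ x) (hx1 : x ≤ 1) :
    0 < q + r * x := by
  rcases le_or_gt x (1 / 2) with h | h
  · nlinarith
  · nlinarith

/-- Positivity data of a Möbius chart: `Q > 0` and `Q + R > 0` on `[0,1]`. -/
structure MoebiusData where
  /-- `q(y)` -/
  Q : MvPolynomial (Fin 1) ℚ
  /-- `r(y)` -/
  R : MvPolynomial (Fin 1) ℚ
  /-- `q > 0` on `[0,1]` -/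
  hQ : ∀ t ∈ Icc (0 : ℝ) 1, 0 < pv Q t
  /-- `q + r > 0` on `[0,1]` -/
  hQR : ∀ t ∈ Icc (0 : ℝ) 1, 0 < pv Q t + pv R t

namespace MoebiusData

variable (μ : MoebiusData)

end MoebiusData

end Summit.KontsevichZagierPeriods.RootDecompRationalCubeDichotomy.ArctanFibre

end
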